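import Summits.ABC.IUTFork.Joshi.ATS4DescentSpineVolFreeResidual
import HarnessLib

/-!
# [J-IV] (arXiv:2403.10430v2) §6.10–§6.11: the SINGLE-PRIME OBSTRUCTION to the per-prime residual at GENUINE components — one prime whose
# local `q`-excess beats the global cap `(1/2ℓ)·log 𝔮_F` makes (R4′) ∧ (R5) UNSATISFIABLE in the volumes
# (R-J census row Y-21, parent word — kernel form of abc-iut-E-cx-3's lane-3 mechanism §C3, modulo the two genuine local numbers)

Proof-only sequel (0 defs) of `Joshi/ATS4DescentSpineVolFreeResidual.lean` (abc-iut-E-t50 gen 8, p468721; R-J «JOSHI Y-DISCHARGE CENSUS»,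
rung LADDER-ABC:A2.RESCUE.J). abc-iut-E-cx-3's adversary verdict on the Y-21 parent word (STATUS 21:30:00Z; memo
`HOME/plan/E/cx-3/Y21-PARENT-READ.md` §C2–C3) observes ON PAPER that at GENUINE components the per-prime positive-part residual
`Σ_{p∈V} max(0, −B_p) ≤ (1/2ℓ)·log 𝔮_F` (E-t33's `abc_of_genuineResidualSupport` through `residual_iff_volFree` =
`abc_of_volFreeResidualSupport`) FAILS on the Legendre family `λ_N = 2·3^N/(3^N − 7)`: at `p = 3` the `q`-component is `≍ N` while the
different component and the Mertens term are bounded, and (6.11.1)'s `Σ_p |·|` convention lets NO other prime absorb the excess. THIS FILE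
types the MECHANISM as real arithmetic, leaving exactly the two genuine local numbers as hypotheses:
* `neg_bracket_le_of_perPrime_residual` — the per-prime residual caps EVERY single bracket: `−B_{p₀} ≤ (1/2ℓ)·log 𝔮_F` for each `p₀ ∈ V`
  (one nonnegative term of the sum). [folklore]
* `not_exists_volumes_of_localExcess` — hence if at ONE prime `p₀ ∈ V` the local excess beats the cap,
  `(1/2ℓ)·Q < ((ℓ+1)/4)·(q_{p₀}/6 − (1+4/ℓ)·d_{p₀} − (4/ℓ)·log p₀ − (20/3)·e*·ι_{p₀}·(log p₀)/p₀)`, then there are NO volumes `vol`, `vol_∞`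
  with (R4′) at every `p ∈ V` and (R5) — for ANY values of the other components (`residual_iff_volFree` forwards + the cap). [folklore]
What remains for a kernel countermodel to the genuine-component antecedent («residualSupport_unsat_at_lambdaN», E-cx-3's target) is
GENUINE ARITHMETIC only: a lower bound for the fibre sum `q_3(λ_N)` and upper bounds for `d_3` in the division tower and for `log 𝔮_F` —
the E-t35 / E-t27 fibre-sum API; not attempted here. FRAMING (binding): real-number bookkeeping; NO side taken on [IUTchIII] Cor. 3.12 /
[IUTchIV] Thm. 1.10, on Joshi's claims or on Mochizuki's report; NOT an abc claim; located ≠ adjudicated; typed ≠ proved ≠ endorsed.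
Theorems only; standard axioms. [claim: Joshi2024ATS4, status: disputed] (locators as in the parents).
-/

noncomputable section

namespace Summit.ABC.IUTFork.Joshi.ATS4
open Finset

/-- **The per-prime residual caps every single bracket**: if `Σ_{p∈V} max(0, −B_p) ≤ C` then `−B_{p₀} ≤ C` for each `p₀ ∈ V`
(the other terms are `≥ 0`). [folklore] -/
theorem neg_bracket_le_of_perPrime_residual (V : Finset ℕ) (B : ℕ → ℝ) {C : ℝ}
    (h : ∑ p ∈ V, max 0 (-B p) ≤ C) {p₀ : ℕ} (hp₀ : p₀ ∈ V) : -B p₀ ≤ C :=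
  (le_max_right 0 (-B p₀)).trans
    ((Finset.single_le_sum (f := fun p => max 0 (-B p)) (fun q _ => le_max_left 0 (-B q)) hp₀).trans h)

/-- **SINGLE-PRIME OBSTRUCTION.** For `ℓ ≥ 2`, components `DLp`, `qAt`, a Mertens coefficient `E`, threshold `N` and total `Q`: if at ONE
prime `p₀ ∈ V` the local excess beats the global cap,
`(1/2ℓ)·Q < ((ℓ+1)/4)·(qAt p₀/6 − (1+4/ℓ)·DLp p₀ − (4/ℓ)·log p₀ − (20/3)·E·ι_{p₀}·(log p₀)/p₀)`,
then NO volumes satisfy (R4′) «∀ p ∈ V, −(1/ℓ⋆)|vol p| ≤ B_p» ∧ (R5) «−(1/2ℓ)·Q ≤ −(1/ℓ⋆)(Σ_p |vol p| + |vol_∞|)» — whatever the components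
at the other primes ((6.11.1) sums absolute values, so no other prime absorbs `p₀`'s excess). The real-arithmetic kernel of abc-iut-E-cx-3's
countermodel mechanism; the genuine numbers at `λ_N`, `p₀ = 3` are NOT supplied here. [folklore] -/
theorem not_exists_volumes_of_localExcess (ℓ : ℕ) (h2 : 2 ≤ ℓ) (V : Finset ℕ) (DLp qAt : ℕ → ℝ) (E Q : ℝ) (N : ℕ)
    {p₀ : ℕ} (hp₀ : p₀ ∈ V)
    (hexcess : 1 / (2 * (ℓ : ℝ)) * Q < ((ℓ : ℝ) + 1) / 4 *
      (1 / 6 * qAt p₀ - (1 + 4 / (ℓ : ℝ)) * DLp p₀ - 4 / (ℓ : ℝ) * Real.log p₀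
        - 20 / 3 * E * (if p₀ ≤ N then Real.log p₀ / p₀ else 0))) :
    ¬ ∃ (vol : ℕ → ℝ) (volArch : ℝ), (∀ p ∈ V, -(1 / (((ℓ : ℝ) - 1) / 2)) * |vol p| ≤ ((ℓ : ℝ) + 1) / 4 *
        ((1 + 4 / (ℓ : ℝ)) * DLp p - 1 / 6 * qAt p + 4 / (ℓ : ℝ) * Real.log p
          + 20 / 3 * E * (if p ≤ N then Real.log p / p else 0))) ∧
      -(1 / (2 * (ℓ : ℝ)) * Q) ≤ -(1 / (((ℓ : ℝ) - 1) / 2)) * (∑ p ∈ V, |vol p| + |volArch|) := by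
  intro hex
  have hsum := (residual_iff_volFree ℓ h2 V (fun p => ((ℓ : ℝ) + 1) / 4 *
    ((1 + 4 / (ℓ : ℝ)) * DLp p - 1 / 6 * qAt p + 4 / (ℓ : ℝ) * Real.log p
      + 20 / 3 * E * (if p ≤ N then Real.log p / p else 0))) Q).mp hex
  have hcap := neg_bracket_le_of_perPrime_residual V _ hsum hp₀
  have : -(((ℓ : ℝ) + 1) / 4 * ((1 + 4 / (ℓ : ℝ)) * DLp p₀ - 1 / 6 * qAt p₀ + 4 / (ℓ : ℝ) * Real.log p₀
      + 20 / 3 * E * (if p₀ ≤ N then Real.log p₀ / p₀ else 0))) =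
      ((ℓ : ℝ) + 1) / 4 * (1 / 6 * qAt p₀ - (1 + 4 / (ℓ : ℝ)) * DLp p₀ - 4 / (ℓ : ℝ) * Real.log p₀
        - 20 / 3 * E * (if p₀ ≤ N then Real.log p₀ / p₀ else 0)) := by ring
  rw [this] at hcap
  exact absurd (hcap.trans_lt hexcess) (lt_irrefl _)

end Summit.ABC.IUTFork.Joshi.ATS4

end
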